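import Mathlib
import Literature.Barriers.MatrixMultiplication.NormalizerBarrier
import Literature.RepresentationTheory.FiniteGroups.CharacterDegrees
import Literature.RepresentationTheory.FiniteGroups.IrreducibleCharacters
import Summits.MatrixMultiplication.MatrixMultiplication.Theorems.LieRankDesigns.Negative.Basics
import Summits.MatrixMultiplication.MatrixMultiplication.Theorems.SubgroupIdentityDesigns.Negative.BlockSliceTypes
import Summits.MatrixMultiplication.MatrixMultiplication.Theorems.SubgroupIdentityDesigns.Negative.BlockSliceNoGo

/-!
# Block slices, IV: the graded-budget inequality of the crux FAILS on slice triples,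
# conditionally on one character-degree fact (BLOCK-SLICES Thm 2.4, assembled)

Negative lemma for the crux `SubgroupIdentityDesigns` (stmt-MatrixMultiplication-14079), route
`LevelGradedCohnUmans`.  VALUE = theorem (a conditional no-go), NOT summit progress.

The crux asks, for every `ε > 0`, for subgroups `H₁ H₂ H₃ ≤ GL_m(𝔽_p)` with the subgroup TPP, an
identity test of Fourier level `≤ k`, and the graded-budget inequality
`Σᶠ_{χ ∈ Irr(GL_m(𝔽_p)), level χ ≤ k} χ(1)^{2+ε} < (|H₁||H₂||H₃|)^{(2+ε)/3}`.
The only known source of identity tests at low level are the BLOCK SLICES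
`S = {g : lower-right l × l block of g is 1}` of `GL_{k+l}` (level `≤ k`) and their conjugates
(`ORACLE-g8.md` §G8-2c).  `BlockSliceNoGo.volume_sq_lt` (kernel-checked, this directory) bounds the
volume of every TPP triple with products in such a slice: `V² < (p^{kl+k(k-1)/2})⁶` once `l ≥ 3`.

This file assembles that packing bound with the budget side **in the crux's literal terms**, in
the vocabulary of `LieRankDesigns/Negative/Basics.lean` (`levelSet p m k`, `budget p m k s =
Σᶠ_{χ ∈ irrChars ∩ levelSet} (χ 1).re ^ s` — definitionally the crux's inlined clauses):
* `rpow_le_budget` — every single level-`≤ k` irreducible character is dominated by the budget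
  (the finsum is a finite sum of non-negative terms: `irrChars_finite_holds`, `χ(1) = dim ≥ 0`);
* BLOCK-SLICES Lemma 2.1 enters as EXPLICIT HYPOTHESES `(hχ : χ ∈ irrChars ∩ levelSet) (hχdeg :
  D ≤ (χ 1).re)`: some irreducible character of `GL_{k+l}(𝔽_p)` of level `≤ k` has degree
  `≥ D = p^{kl+k(k-1)/2}`.  (True: the
  unipotent character `χ^{(l,1^k)}`, a constituent of `Ind_{P_k}(St_k ⊗ 1) ⊆ ℂ[G/H_k]`, has degree
  `p^{k(k+1)/2}·[k+l-1 choose k]_p ≥ D` — standard (Green 1955 / James 1984), but unipotent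
  characters of `GL_n(q)` are not in Mathlib or the tree, so it is carried as a hypothesis here and
  is the ONE remaining paper-grade input of BLOCK-SLICES §2);
* `not_budget_lt_of_slice` — **for `k ≥ 1`, `l ≥ 3`, given such a `χ`, NO subgroup-TPP
  triple of `GL_{k+l}(𝔽_p)` whose triple products lie in a conjugate `x S x⁻¹` of the block slice
  satisfies the crux's budget inequality, for ANY exponent `s > 0`** (in particular `s = 2 + ε`):
  `budget ≥ χ(1)^s ≥ D^s = (D³)^{s/3} > V^{s/3}`.

So, granted Lemma 2.1, block-slice identity tests can never witness the crux (for `m ≥ k + 3`);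
the cases `l ≤ 2` are uninteresting for the exponent (`m ≤ k + 2`).
-/

set_option linter.dupNamespace false

open scoped BigOperators Matrix
open Literature.Barriers.MatrixMultiplication
open Literature.RepresentationTheory.FiniteGroups

namespace Summit.MatrixMultiplication.MatrixMultiplication.Theorems.SubgroupIdentityDesigns.Negative.BlockSliceConditional

open BlockSliceTypes BlockSliceNoGo
open Summit.MatrixMultiplication.MatrixMultiplication.Theorems.LieRankDesigns.Negative

/-! ## The crux's budget side -/

/-- **Every level-`≤ k` irreducible character is dominated by the budget**: for `χ` in the
crux's index set `irrChars ∩ levelSet p m k` and any real `s`, `(χ 1).re ^ s ≤ budget p m k s`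
(a finite sum of non-negative terms, `irrChars_finite_holds`, `re_apply_one_nonneg`). -/
theorem rpow_le_budget {p m k : ℕ} [Fact p.Prime] {χ : GLm p m → ℂ}
    (hχ : χ ∈ irrChars (GLm p m) ∩ levelSet p m k) (s : ℝ) :
    (χ 1).re ^ s ≤ budget p m k s := by
  have hfin : (irrChars (GLm p m) ∩ levelSet p m k).Finite :=
    (irrChars_finite_holds (GLm p m)).subset Set.inter_subset_left
  unfold budget
  rw [finsum_mem_eq_finite_toFinset_sum _ hfin]
  refine Finset.single_le_sum (f := fun ψ : GLm p m → ℂ => (ψ 1).re ^ s)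
    (fun ψ hψ => ?_) (hfin.mem_toFinset.mpr hχ)
  exact Real.rpow_nonneg (re_apply_one_nonneg (hfin.mem_toFinset.mp hψ).1) s

/-! ## The one paper-grade input, as a hypothesis

**BLOCK-SLICES Lemma 2.1** — some irreducible character `χ` of `GL_{k+l}(𝔽_p)` of Fourier level
`≤ k` (in the crux's sense) has degree at least `D = p^{kl + k(k-1)/2}` — is TRUE (the unipotent
character `χ^{(l,1^k)}` of degree `p^{k(k+1)/2}[k+l-1 choose k]_p`, a constituent of
`ℂ[G/H_k] ⊆ F_k`), standard but absent from Mathlib and the tree; below it enters as the two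
explicit hypotheses `(hχ : χ ∈ irrChars _ ∩ levelSet p (k + l) k) (hχdeg : D ≤ (χ 1).re)` of the
no-go theorems (no `Prop` is vendored into this directory). -/

/-! ## Transport of the slice hypotheses to `GL (Fin k ⊕ Fin l)` -/

section transport

variable {F : Type*} [Field F] {k l : ℕ}

/-- The injective hom `g ↦ toSum (x⁻¹ g x)` from `GL_{k+l}(F)` to `GL (Fin k ⊕ Fin l) F`. -/
noncomputable def conjToSum (x : GL (Fin (k + l)) F) : GL (Fin (k + l)) F →* GL (Fin k ⊕ Fin l) F :=
  (toSumHom (F := F) (k := k) (l := l)).comp (MulAut.conj x⁻¹).toMonoidHom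

/-- `conjToSum x` is injective. -/
theorem conjToSum_injective (x : GL (Fin (k + l)) F) :
    Function.Injective (conjToSum (F := F) x) :=
  toSumHom_injective.comp (MulAut.conj x⁻¹).injective

end transport

/-! ## The conditional no-go -/

variable {p : ℕ} [Fact p.Prime] {k l : ℕ}

/-- **Volume bound for slice triples in `GL_{k+l}(𝔽_p)`, cube-root form**: if `H₁ H₂ H₃` satisfy
the subgroup TPP and all triple products lie in the conjugate block slice
`x S x⁻¹ = {g : lower-right l × l block of x⁻¹ g x is 1}`, `k ≥ 1`, `l ≥ 3`, then
`|H₁||H₂||H₃| < (p^{kl + k(k-1)/2})³ = D³`. -/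
theorem volume_lt_cube (hk : 1 ≤ k) (hl : 3 ≤ l)
    {H₁ H₂ H₃ : Subgroup (GL (Fin (k + l)) (ZMod p))} (htpp : SubgroupTPP H₁ H₂ H₃)
    (x : GL (Fin (k + l)) (ZMod p))
    (hS : ∀ a ∈ H₁, ∀ b ∈ H₂, ∀ c ∈ H₃, ∀ i j : Fin l,
      ((x⁻¹ * (a * b * c) * x : GL (Fin (k + l)) (ZMod p)) : Matrix (Fin (k + l)) (Fin (k + l)) (ZMod p))
        (Fin.natAdd k i) (Fin.natAdd k j) = (1 : Matrix (Fin l) (Fin l) (ZMod p)) i j) :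
    Nat.card H₁ * Nat.card H₂ * Nat.card H₃ < (p ^ (k * l + k * (k - 1) / 2)) ^ 3 := by
  have hφ : Function.Injective (conjToSum (F := ZMod p) (k := k) (l := l) x) :=
    conjToSum_injective x
  -- the transported triple satisfies the TPP and has products in the block slice
  have htpp' : SubgroupTPP (H₁.map (conjToSum x)) (H₂.map (conjToSum x))
      (H₃.map (conjToSum (k := k) (l := l) x)) := by
    rintro _ ⟨a, ha, rfl⟩ _ ⟨b, hb, rfl⟩ _ ⟨c, hc, rfl⟩ h
    rw [← map_mul, ← map_mul, map_eq_one_iff _ hφ] at h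
    obtain ⟨h1, h2, h3⟩ := htpp a ha b hb c hc h
    exact ⟨by rw [h1, map_one], by rw [h2, map_one], by rw [h3, map_one]⟩
  have hS' : ∀ a ∈ H₁.map (conjToSum x), ∀ b ∈ H₂.map (conjToSum x),
      ∀ c ∈ H₃.map (conjToSum (k := k) (l := l) x), Dblk (a * b * c) = 1 := by
    rintro _ ⟨a, ha, rfl⟩ _ ⟨b, hb, rfl⟩ _ ⟨c, hc, rfl⟩
    rw [← map_mul, ← map_mul]
    ext i j
    show Dblk (toSumHom ((MulAut.conj x⁻¹) (a * b * c))) i j = _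
    rw [Dblk_toSum, MulAut.conj_apply, inv_inv]
    exact hS a ha b hb c hc i j
  have h := (volume_sq_lt (F := ZMod p) hk htpp' hS').2 hl
  rw [Subgroup.card_map_of_injective hφ, Subgroup.card_map_of_injective hφ,
    Subgroup.card_map_of_injective hφ, Nat.card_zmod] at h
  -- `V² < D⁶ = (D³)²` gives `V < D³`
  refine not_le.mp fun hle => ?_
  have h2 : ((p ^ (k * l + k * (k - 1) / 2)) ^ 3) ^ 2 ≤
      (Nat.card H₁ * Nat.card H₂ * Nat.card H₃) ^ 2 := Nat.pow_le_pow_left hle 2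
  have h3 : ((p ^ (k * l + k * (k - 1) / 2)) ^ 3) ^ 2 = (p ^ (k * l + k * (k - 1) / 2)) ^ 6 := by
    ring
  rw [h3] at h2
  exact lt_irrefl _ (lt_of_le_of_lt h2 h)

/-- **Conditional no-go (BLOCK-SLICES Thm 2.4, assembled in the crux's terms).**  Let `k ≥ 1`,
`l ≥ 3`, and grant Lemma 2.1: an irreducible character `χ` of `GL_{k+l}(𝔽_p)` of level `≤ k` with
`(χ 1).re ≥ D = p^{kl + k(k-1)/2}`.  Then for every subgroup-TPP triple
`H₁ H₂ H₃ ≤ GL_{k+l}(𝔽_p)` whose triple products all lie in a conjugate block slice `x S x⁻¹`, and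
every exponent `s > 0`, the crux's budget inequality FAILS:
`¬ (Σᶠ_{χ ∈ Irr ∩ level ≤ k} (χ 1).re ^ s < (|H₁||H₂||H₃|)^{s/3})`.
With `s = 2 + ε` this is literally the negation of the last clause of `SubgroupIdentityDesigns`
at `m = k + l` for these triples. -/
theorem not_budget_lt_of_slice (hk : 1 ≤ k) (hl : 3 ≤ l)
    {χ : GLm p (k + l) → ℂ} (hχ : χ ∈ irrChars (GLm p (k + l)) ∩ levelSet p (k + l) k)
    (hχdeg : ((p ^ (k * l + k * (k - 1) / 2) : ℕ) : ℝ) ≤ (χ 1).re)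
    {H₁ H₂ H₃ : Subgroup (GL (Fin (k + l)) (ZMod p))} (htpp : SubgroupTPP H₁ H₂ H₃)
    (x : GL (Fin (k + l)) (ZMod p))
    (hS : ∀ a ∈ H₁, ∀ b ∈ H₂, ∀ c ∈ H₃, ∀ i j : Fin l,
      ((x⁻¹ * (a * b * c) * x : GL (Fin (k + l)) (ZMod p)) : Matrix (Fin (k + l)) (Fin (k + l)) (ZMod p))
        (Fin.natAdd k i) (Fin.natAdd k j) = (1 : Matrix (Fin l) (Fin l) (ZMod p)) i j)
    {s : ℝ} (hs : 0 < s) :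
    ¬ (budget p (k + l) k s < ((Nat.card H₁ * Nat.card H₂ * Nat.card H₃ : ℕ) : ℝ) ^ (s / 3)) := by
  intro hlt
  have hV := volume_lt_cube hk hl htpp x hS
  set D : ℕ := p ^ (k * l + k * (k - 1) / 2) with hD
  have hD0 : (0 : ℝ) ≤ (D : ℝ) := Nat.cast_nonneg D
  -- `V^{s/3} < (D³)^{s/3} = D^s ≤ χ(1)^s ≤ budget`
  have h1 : ((Nat.card H₁ * Nat.card H₂ * Nat.card H₃ : ℕ) : ℝ) ^ (s / 3) <
      ((D ^ 3 : ℕ) : ℝ) ^ (s / 3) :=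
    Real.rpow_lt_rpow (Nat.cast_nonneg _) (by exact_mod_cast hV) (by positivity)
  have h2 : ((D ^ 3 : ℕ) : ℝ) ^ (s / 3) = (D : ℝ) ^ s := by
    rw [Nat.cast_pow, ← Real.rpow_natCast (D : ℝ) 3, ← Real.rpow_mul hD0]
    congr 1
    push_cast
    ring
  have h3 : (D : ℝ) ^ s ≤ (χ 1).re ^ s := Real.rpow_le_rpow hD0 hχdeg hs.le
  have h4 : (χ 1).re ^ s ≤ budget p (k + l) k s := rpow_le_budget hχ s
  linarith

/-- The same at the crux's exponents `2 + ε`, `(2 + ε) / 3` (any `ε > -2`, in particular every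
`ε > 0`). -/
theorem not_budget_lt_of_slice_eps (hk : 1 ≤ k) (hl : 3 ≤ l)
    {χ : GLm p (k + l) → ℂ} (hχ : χ ∈ irrChars (GLm p (k + l)) ∩ levelSet p (k + l) k)
    (hχdeg : ((p ^ (k * l + k * (k - 1) / 2) : ℕ) : ℝ) ≤ (χ 1).re)
    {H₁ H₂ H₃ : Subgroup (GL (Fin (k + l)) (ZMod p))} (htpp : SubgroupTPP H₁ H₂ H₃)
    (x : GL (Fin (k + l)) (ZMod p))
    (hS : ∀ a ∈ H₁, ∀ b ∈ H₂, ∀ c ∈ H₃, ∀ i j : Fin l,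
      ((x⁻¹ * (a * b * c) * x : GL (Fin (k + l)) (ZMod p)) : Matrix (Fin (k + l)) (Fin (k + l)) (ZMod p))
        (Fin.natAdd k i) (Fin.natAdd k j) = (1 : Matrix (Fin l) (Fin l) (ZMod p)) i j)
    {ε : ℝ} (hε : 0 < ε) :
    ¬ ((∑ᶠ ψ ∈ irrChars (GLm p (k + l)) ∩ levelSet p (k + l) k, (ψ 1).re ^ (2 + ε)) <
        ((Nat.card H₁ * Nat.card H₂ * Nat.card H₃ : ℕ) : ℝ) ^ ((2 + ε) / 3)) :=
  not_budget_lt_of_slice hk hl hχ hχdeg htpp x hS (s := 2 + ε) (by linarith)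

end Summit.MatrixMultiplication.MatrixMultiplication.Theorems.SubgroupIdentityDesigns.Negative.BlockSliceConditional
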